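import Literature.NumberTheory.EllipticCurves.IwasawaAlgebraCharIdealProofs
import Literature.RingTheory.Length.TorsionSnake
import Mathlib.RingTheory.QuotSMulTop
import Mathlib.RingTheory.Ideal.UFD
import Mathlib.LinearAlgebra.Matrix.Charpoly.LinearMap
import HarnessLib

/-!
# Local lengths along the snake of multiplication by `x`; characteristic ideals of cyclic modules
# over a factorial Noetherian domain (proofs)

Helper file (Summits/…/Theorems, --supports stmt-BirchSwinnertonDyer-20727): generic commutative algebra in the currency of the tree's
`IwasawaAlgebra.lean` (`Module.lengthAt`, `Module.charIdeal = ∏_{ht 𝔭 = 1} 𝔭 ^ ℓ_𝔭`), used by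
`SignedBaseChangeAnticyclotomicEisensteinDivisibilitySpecializationCyclic.lean` / `SignedBaseChangeAnticyclotomicEisensteinDivisibilitySpecializationHerbrand.lean` (Herbrand
formula `ch_A(N/XN) = ch_A(N[X]) · ch_{A⟦X⟧}(N)(0)` for `X ↦ 0`, in particular `Λ₂ = ℤ_p⟦T₂⟧⟦T₁⟧ → Λ₁`).
Theorems only, [folklore] (Bourbaki AC VII §4.4–4.5; Fulton App. A; Matsumura Thm. 2.1):
* `Module.lengthAt_six_term`, `Module.lengthAt_smul_snake` — alternating identity of local lengths along
  a six-term exact sequence / along the snake `0 → N₁[x] → N₂[x] → N₃[x] → N₁/x → N₂/x → N₃/x → 0`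
  of a short exact sequence of `R`-modules read over a subring of scalars `A → R`
  (tree `Length.TorsionSnake.length_six_term`, Mathlib `SnakeLemma.δ'`, `QuotSMulTop.map_exact`);
* `Module.isPrincipal_charIdeal_of_ufm`, `Module.lengthAt_ne_zero_of_charIdeal_le`,
  `Module.charIdeal_quotient_prime_of_height_eq_one` / `_of_height_ne_one`,
  (and the tree's `X11b.CongruenceLimit.charIdeal_quotient_span_singleton`, `char(R/(g)) = (g)`);
* `Module.smul_eq_map_smul_of_retraction`, `moduleFinite_of_retraction`, `isTorsionBy_map_of_retraction`
  (an `A`-algebra `R` acting through a retraction `π : R → A`);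
* `Module.exists_notMem_forall_smul_eq_zero_of_lengthAt_eq_zero`,
  `Module.lengthAt_eq_zero_of_forall_exists_notMem` (Cayley–Hamilton), transport lemmas.
Lead-prover seat of stmt-BirchSwinnertonDyer-20727 (route SignedBaseChange, stub S2); nothing about
elliptic curves is asserted. References: Bourbaki, *Algèbre commutative* VII §4.4–4.5; Fulton,
*Intersection Theory* (1998) App. A, Lemmas A.1.1, A.2.4; Matsumura, *Commutative Ring Theory* Thm. 2.1. -/

noncomputable section

open Function
open scoped Pointwise

-- D-0017: single-problem summit, the namespace repeats the problem name by design.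
set_option linter.dupNamespace false
set_option autoImplicit false

namespace Summit.BirchSwinnertonDyer.BirchSwinnertonDyer.Theorems.SignedBaseChangeAcDivSpecialization

open Literature.NumberTheory.EllipticCurves Literature.NumberTheory.EllipticCurves.Module

namespace LocalLength

/-! ### Local lengths in a six-term exact sequence -/

section SixTerm

variable {R : Type*} [CommRing R] {M₁ M₂ M₃ M₄ M₅ M₆ : Type*}
  [AddCommGroup M₁] [Module R M₁] [AddCommGroup M₂] [Module R M₂]
  [AddCommGroup M₃] [Module R M₃] [AddCommGroup M₄] [Module R M₄]
  [AddCommGroup M₅] [Module R M₅] [AddCommGroup M₆] [Module R M₆]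

/-- For an exact sequence `0 → M₁ → M₂ → M₃ → M₄ → M₅ → M₆ → 0` and any prime `𝔭`, the local
lengths satisfy `ℓ_𝔭(M₂) + ℓ_𝔭(M₄) + ℓ_𝔭(M₆) = ℓ_𝔭(M₁) + ℓ_𝔭(M₃) + ℓ_𝔭(M₅)` in `ℕ∞`
(localisation at `𝔭` is exact; Fulton, *Intersection Theory*, Lemma A.1.1). [folklore] -/
theorem lengthAt_six_term (f₁ : M₁ →ₗ[R] M₂) (f₂ : M₂ →ₗ[R] M₃) (f₃ : M₃ →ₗ[R] M₄)
    (f₄ : M₄ →ₗ[R] M₅) (f₅ : M₅ →ₗ[R] M₆) (h₁ : Injective f₁) (h₂ : Exact f₁ f₂)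
    (h₃ : Exact f₂ f₃) (h₄ : Exact f₃ f₄) (h₅ : Exact f₄ f₅) (h₆ : Surjective f₅)
    (𝔭 : PrimeSpectrum R) :
    lengthAt R M₂ 𝔭 + lengthAt R M₄ 𝔭 + lengthAt R M₆ 𝔭 =
      lengthAt R M₁ 𝔭 + lengthAt R M₃ 𝔭 + lengthAt R M₅ 𝔭 :=
  Literature.RingTheory.Length.length_six_term
    (LocalizedModule.map 𝔭.asIdeal.primeCompl f₁) (LocalizedModule.map 𝔭.asIdeal.primeCompl f₂)
    (LocalizedModule.map 𝔭.asIdeal.primeCompl f₃) (LocalizedModule.map 𝔭.asIdeal.primeCompl f₄)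
    (LocalizedModule.map 𝔭.asIdeal.primeCompl f₅)
    (LocalizedModule.map_injective _ f₁ h₁) (LocalizedModule.map_exact _ f₁ f₂ h₂)
    (LocalizedModule.map_exact _ f₂ f₃ h₃) (LocalizedModule.map_exact _ f₃ f₄ h₄)
    (LocalizedModule.map_exact _ f₄ f₅ h₅) (LocalizedModule.map_surjective _ f₅ h₆)

end SixTerm

/-! ### The snake sequence of multiplication by `x`, read over a subring of scalars -/

section Snake

variable {A : Type*} [CommRing A] {R : Type*} [CommRing R] [Algebra A R] (x : R)
  {N₁ N₂ N₃ : Type*}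
  [AddCommGroup N₁] [Module R N₁] [Module A N₁] [IsScalarTower A R N₁]
  [AddCommGroup N₂] [Module R N₂] [Module A N₂] [IsScalarTower A R N₂]
  [AddCommGroup N₃] [Module R N₃] [Module A N₃] [IsScalarTower A R N₃]
  (f : N₁ →ₗ[R] N₂) (g : N₂ →ₗ[R] N₃) (hf : Injective f) (hg : Surjective g) (hfg : Exact f g)

include hf hg hfg in
/-- **Local Herbrand bookkeeping along the snake.** Let `A → R` be an algebra, `x ∈ R`, and
`0 → N₁ → N₂ → N₃ → 0` a short exact sequence of `R`-modules. The snake lemma for multiplication by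
`x` gives the exact sequence `0 → N₁[x] → N₂[x] → N₃[x] → N₁/xN₁ → N₂/xN₂ → N₃/xN₃ → 0`; reading
it as a sequence of `A`-modules and localising at a prime `𝔮` of `A`:
`ℓ_𝔮(N₂[x]) + ℓ_𝔮(N₁/x) + ℓ_𝔮(N₃/x) = ℓ_𝔮(N₁[x]) + ℓ_𝔮(N₃[x]) + ℓ_𝔮(N₂/x)` in `ℕ∞`
(Fulton, *Intersection Theory*, Lemma A.2.4; Bourbaki AC VII §4.5). [folklore] -/
theorem lengthAt_smul_snake (𝔮 : PrimeSpectrum A) :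
    lengthAt A (Submodule.torsionBy R N₂ x) 𝔮 + lengthAt A (QuotSMulTop x N₁) 𝔮 +
        lengthAt A (QuotSMulTop x N₃) 𝔮 =
      lengthAt A (Submodule.torsionBy R N₁ x) 𝔮 + lengthAt A (Submodule.torsionBy R N₃ x) 𝔮 +
        lengthAt A (QuotSMulTop x N₂) 𝔮 := by
  have hsq₁ : f.comp (DistribSMul.toLinearMap R N₁ x) = (DistribSMul.toLinearMap R N₂ x).comp f := by
    ext; simp
  have hsq₂ : g.comp (DistribSMul.toLinearMap R N₂ x) = (DistribSMul.toLinearMap R N₃ x).comp g := by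
    ext; simp
  let δ := SnakeLemma.δ' (DistribSMul.toLinearMap R N₁ x) (DistribSMul.toLinearMap R N₂ x)
    (DistribSMul.toLinearMap R N₃ x) f g hfg f g hfg hsq₁ hsq₂
    (Submodule.torsionBy R N₃ x).subtype (Literature.RingTheory.Length.exact_subtype_smulMap x N₃)
    (Submodule.mkQ (x • ⊤)) (Literature.RingTheory.Length.exact_smulMap_mkQ x N₁) hg hf
  have e₁ : Injective (f.restrict (Literature.RingTheory.Length.mapsTo_torsionBy x f)) :=
    Literature.RingTheory.Length.restrict_torsionBy_injective x f hf
  have e₂ := Literature.RingTheory.Length.exact_restrict_torsionBy x f g hf hfg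
  have e₃ : Exact (g.restrict (Literature.RingTheory.Length.mapsTo_torsionBy x g)) δ :=
    SnakeLemma.exact_δ'_right (DistribSMul.toLinearMap R N₁ x) (DistribSMul.toLinearMap R N₂ x)
      (DistribSMul.toLinearMap R N₃ x) f g hfg f g hfg hsq₁ hsq₂
      (Submodule.torsionBy R N₂ x).subtype (Literature.RingTheory.Length.exact_subtype_smulMap x N₂)
      (Submodule.torsionBy R N₃ x).subtype (Literature.RingTheory.Length.exact_subtype_smulMap x N₃)
      (Submodule.mkQ (x • ⊤)) (Literature.RingTheory.Length.exact_smulMap_mkQ x N₁) hg hf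
      (g.restrict (Literature.RingTheory.Length.mapsTo_torsionBy x g)) rfl
      (Submodule.injective_subtype _)
  have e₄ : Exact δ (QuotSMulTop.map x f) :=
    SnakeLemma.exact_δ'_left (DistribSMul.toLinearMap R N₁ x) (DistribSMul.toLinearMap R N₂ x)
      (DistribSMul.toLinearMap R N₃ x) f g hfg f g hfg hsq₁ hsq₂
      (Submodule.torsionBy R N₃ x).subtype (Literature.RingTheory.Length.exact_subtype_smulMap x N₃)
      (Submodule.mkQ (x • ⊤)) (Literature.RingTheory.Length.exact_smulMap_mkQ x N₁)
      (Submodule.mkQ (x • ⊤)) (Literature.RingTheory.Length.exact_smulMap_mkQ x N₂) hg hf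
      (QuotSMulTop.map x f) (QuotSMulTop.map_comp_mkQ x f) (Submodule.mkQ_surjective _)
  have e₅ := QuotSMulTop.map_exact x hfg hg
  have e₆ := QuotSMulTop.map_surjective x hg
  exact lengthAt_six_term
    ((f.restrict (Literature.RingTheory.Length.mapsTo_torsionBy x f)).restrictScalars A)
    ((g.restrict (Literature.RingTheory.Length.mapsTo_torsionBy x g)).restrictScalars A)
    (δ.restrictScalars A) ((QuotSMulTop.map x f).restrictScalars A)
    ((QuotSMulTop.map x g).restrictScalars A) e₁ e₂ e₃ e₄ e₅ e₆ 𝔮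

end Snake

/-! ### Characteristic ideals over a factorial Noetherian domain -/

section CharIdeal

variable {R : Type*} [CommRing R] {M : Type*} [AddCommGroup M] [Module R M]

/-- Over a factorial domain the characteristic ideal of any module is principal: each height-one
prime is principal (Mathlib `UniqueFactorizationMonoid.isPrincipal_of_height_eq_one`), hence so is
the (finite, or junk `1`) product `∏ 𝔭 ^ ℓ_𝔭(M)` (Washington §13.2; Bourbaki AC VII §4.5, §3).
[folklore] -/
theorem isPrincipal_charIdeal_of_ufm [IsDomain R] [UniqueFactorizationMonoid R] :
    (charIdeal R M).IsPrincipal := by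
  unfold charIdeal
  rw [← Ideal.mem_isPrincipalSubmonoid_iff]
  refine finprod_mem_induction (· ∈ Ideal.isPrincipalSubmonoid R)
    (Submonoid.one_mem _) (fun _ _ hx hy => Submonoid.mul_mem _ hx hy) ?_
  intro 𝔭 h𝔭
  refine Submonoid.pow_mem _ ?_ _
  obtain ⟨g, hg⟩ := UniqueFactorizationMonoid.isPrincipal_of_height_eq_one h𝔭
  rw [hg]
  exact Ideal.span_singleton_mem_isPrincipalSubmonoid g

/-- Two height-one primes which are comparable are equal. [folklore] -/
theorem eq_of_height_eq_one_of_le' {𝔭 𝔮 : PrimeSpectrum R} (h𝔭 : 𝔭.asIdeal.height = 1)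
    (h𝔮 : 𝔮.asIdeal.height = 1) (hle : 𝔭.asIdeal ≤ 𝔮.asIdeal) : 𝔭 = 𝔮 := by
  haveI : 𝔭.asIdeal.FiniteHeight := by
    rw [Ideal.finiteHeight_iff, h𝔭]; exact Or.inr ENat.one_ne_top
  exact PrimeSpectrum.ext (Ideal.eq_of_le_of_height_le (I := 𝔭.asIdeal) hle (by rw [h𝔭, h𝔮]))

/-- If the characteristic ideal of `M` is contained in a height-one prime `𝔮`, then `M_𝔮 ≠ 0`:
`char(M) = ∏ 𝔭^{ℓ_𝔭(M)}` and a product of ideals inside the prime `𝔮` has a factor inside `𝔮`,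
which for a positive power of a height-one prime `𝔭` forces `𝔭 = 𝔮`. [folklore] -/
theorem lengthAt_ne_zero_of_charIdeal_le {𝔮 : PrimeSpectrum R} (h𝔮 : 𝔮.asIdeal.height = 1)
    (hle : charIdeal R M ≤ 𝔮.asIdeal) : lengthAt R M 𝔮 ≠ 0 := by
  intro h0
  revert hle
  rw [imp_false, charIdeal]
  refine finprod_mem_induction (fun I : Ideal R => ¬ I ≤ 𝔮.asIdeal) ?_ ?_ ?_
  · rw [Ideal.one_eq_top, top_le_iff]; exact 𝔮.isPrime.ne_top
  · intro I J hI hJ hIJ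
    rcases (𝔮.isPrime.mul_le).mp hIJ with h | h
    exacts [hI h, hJ h]
  · intro 𝔭 h𝔭 hpow
    by_cases hn : (lengthAt R M 𝔭).toNat = 0
    · rw [hn, pow_zero, Ideal.one_eq_top, top_le_iff] at hpow
      exact 𝔮.isPrime.ne_top hpow
    · have h := eq_of_height_eq_one_of_le' h𝔭 h𝔮 (Ideal.IsPrime.le_of_pow_le hpow)
      subst h
      rw [h0, ENat.toNat_zero] at hn
      exact hn rfl

/-- `char(R/𝔭) = 𝔭` for a height-one prime `𝔭` of a domain: `ℓ_𝔭(R/𝔭) = 1` and `(R/𝔭)_𝔮 = 0` at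
every other height-one prime `𝔮`. [folklore] -/
theorem charIdeal_quotient_prime_of_height_eq_one (𝔭 : PrimeSpectrum R)
    (h𝔭 : 𝔭.asIdeal.height = 1) : charIdeal R (R ⧸ 𝔭.asIdeal) = 𝔭.asIdeal := by
  unfold charIdeal
  rw [finprod_mem_def, finprod_eq_single _ 𝔭]
  · rw [Set.mulIndicator_of_mem (show 𝔭 ∈ {𝔭 : PrimeSpectrum R | 𝔭.asIdeal.height = 1} from h𝔭),
      lengthAt_quotient_self, ENat.toNat_one, pow_one]
  · intro 𝔮 hne
    by_cases h𝔮 : 𝔮 ∈ {𝔭 : PrimeSpectrum R | 𝔭.asIdeal.height = 1}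
    · rw [Set.mulIndicator_of_mem h𝔮, lengthAt_quotient_eq_zero_of_not_le, ENat.toNat_zero, pow_zero]
      exact fun hle => hne (eq_of_height_eq_one_of_le' h𝔭 h𝔮 hle).symm
    · exact Set.mulIndicator_of_notMem h𝔮 _

/-- `char(R/𝔭) = 1` for a nonzero prime `𝔭` of a domain of height `≠ 1` (then `ht 𝔭 ≥ 2` and
`R/𝔭` is pseudo-null: no height-one prime contains `𝔭`). [folklore] -/
theorem charIdeal_quotient_prime_of_height_ne_one [IsDomain R] (𝔭 : PrimeSpectrum R)
    (h0 : 𝔭.asIdeal ≠ ⊥) (h1 : 𝔭.asIdeal.height ≠ 1) : charIdeal R (R ⧸ 𝔭.asIdeal) = 1 := by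
  unfold charIdeal
  refine finprod_mem_eq_one_of_forall_eq_one fun 𝔮 h𝔮 => ?_
  rw [lengthAt_quotient_eq_zero_of_not_le, ENat.toNat_zero, pow_zero]
  intro hle
  have hlt : 𝔭.asIdeal < 𝔮.asIdeal := lt_of_le_of_ne hle fun h => h1 (h ▸ h𝔮)
  haveI : 𝔮.asIdeal.FiniteHeight := by
    rw [Ideal.finiteHeight_iff, show 𝔮.asIdeal.height = 1 from h𝔮]; exact Or.inr ENat.one_ne_top
  have h := Ideal.height_strict_mono_of_isPrime_of_isPrime hlt
  rw [show 𝔮.asIdeal.height = 1 from h𝔮, Order.lt_one_iff,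
    Ideal.height_eq_zero_iff_eq_bot] at h
  exact h0 h

-- `char(R/(g)) = (g)` for `g ≠ 0` in a factorial Noetherian domain is already in the tree:
-- `Summit.BirchSwinnertonDyer.Rank1Residual.X11b.CongruenceLimit.charIdeal_quotient_span_singleton`.

end CharIdeal

/-! ### Modules on which an `A`-algebra `R` acts through a retraction `π : R → A` -/

section Retraction

variable {A : Type*} [CommRing A] {R : Type*} [CommRing R] [Algebra A R] (π : R →+* A)
  (hπ : ∀ a : A, π (algebraMap A R a) = a)
  {P : Type*} [AddCommGroup P] [Module R P] [Module A P] [IsScalarTower A R P]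
  (hP : ∀ (r : R) (m : P), π r = 0 → r • m = 0)

include hπ hP in
/-- If `ker π` kills `P` then `R` acts on `P` through `π`: `r • m = π(r) • m`. [folklore] -/
theorem smul_eq_map_smul_of_retraction (r : R) (m : P) : r • m = π r • m := by
  have h : (r - algebraMap A R (π r)) • m = 0 := hP _ _ (by rw [map_sub, hπ, sub_self])
  rwa [sub_smul, algebraMap_smul, sub_eq_zero] at h

include hπ hP in
/-- If `ker π` kills the finitely generated `R`-module `P` then `P` is finitely generated over
`A` (the same generators). [folklore] -/
theorem moduleFinite_of_retraction [Module.Finite R P] : Module.Finite A P := by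
  obtain ⟨S, hS⟩ := Module.Finite.fg_top (R := R) (M := P)
  refine ⟨⟨S, ?_⟩⟩
  rw [Submodule.eq_top_iff']
  intro m
  have hm : m ∈ Submodule.span R (S : Set P) := by rw [hS]; exact Submodule.mem_top
  induction hm using Submodule.span_induction with
  | mem y hy => exact Submodule.subset_span hy
  | zero => exact Submodule.zero_mem _
  | add y z _ _ hy hz => exact Submodule.add_mem _ hy hz
  | smul r y _ hy =>
    rw [smul_eq_map_smul_of_retraction π hπ hP]
    exact Submodule.smul_mem _ _ hy

include hπ hP in
/-- If `ker π` kills `P` and `s ∈ R` kills `P`, then `π(s) ∈ A` kills `P`. [folklore] -/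
theorem isTorsionBy_map_of_retraction {s : R} (hs : ∀ m : P, s • m = 0) :
    Module.IsTorsionBy A P (π s) := by
  intro m
  rw [← smul_eq_map_smul_of_retraction π hπ hP, hs]

end Retraction

/-! ### Torsion and cyclic modules: small generic facts -/

section Generic

variable {R : Type*} [CommRing R] {N₁ N₂ : Type*} [AddCommGroup N₁] [Module R N₁]
  [AddCommGroup N₂] [Module R N₂]

/-- A submodule of a torsion module is torsion. [folklore] -/
theorem isTorsion_of_injective' (f : N₁ →ₗ[R] N₂) (hf : Injective f)
    (h : Module.IsTorsion R N₂) : Module.IsTorsion R N₁ := by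
  intro x
  obtain ⟨a, ha⟩ := @h (f x)
  refine ⟨a, hf ?_⟩
  rw [Submonoid.smul_def, map_smul, map_zero]
  exact ha

/-- A quotient of a torsion module is torsion. [folklore] -/
theorem isTorsion_of_surjective' (g : N₁ →ₗ[R] N₂) (hg : Surjective g)
    (h : Module.IsTorsion R N₁) : Module.IsTorsion R N₂ := by
  intro y
  obtain ⟨x, rfl⟩ := hg y
  obtain ⟨a, ha⟩ := @h x
  refine ⟨a, ?_⟩
  rw [Submonoid.smul_def, ← map_smul, ← Submonoid.smul_def, ha, map_zero]

/-- Local lengths do not increase under injections. [folklore] -/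
theorem lengthAt_le_of_injective (f : N₁ →ₗ[R] N₂) (hf : Injective f) (𝔭 : PrimeSpectrum R) :
    lengthAt R N₁ 𝔭 ≤ lengthAt R N₂ 𝔭 :=
  Module.length_le_of_injective (LocalizedModule.map 𝔭.asIdeal.primeCompl f)
    (LocalizedModule.map_injective _ f hf)

/-- Linear equivalences preserve characteristic ideals. [folklore] -/
theorem charIdeal_eq_of_linearEquiv (e : N₁ ≃ₗ[R] N₂) : charIdeal R N₁ = charIdeal R N₂ :=
  finprod_mem_congr rfl fun 𝔭 _ => by rw [lengthAt_eq_of_linearEquiv e 𝔭]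

/-- The characteristic ideal of the zero module is `1`. [folklore] -/
theorem charIdeal_eq_one_of_subsingleton [Subsingleton N₁] : charIdeal R N₁ = 1 :=
  finprod_mem_eq_one_of_forall_eq_one fun 𝔭 _ => by
    rw [lengthAt_eq_zero_of_subsingleton, ENat.toNat_zero, pow_zero]

/-- For a finitely generated module with `M_𝔭 = 0`, a single element outside `𝔭` kills `M`
(product of the elementwise witnesses over a finite generating set). [folklore] -/
theorem exists_notMem_forall_smul_eq_zero_of_lengthAt_eq_zero [Module.Finite R N₁]
    {𝔭 : PrimeSpectrum R} (h : lengthAt R N₁ 𝔭 = 0) :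
    ∃ s ∉ 𝔭.asIdeal, ∀ m : N₁, s • m = 0 := by
  classical
  rw [lengthAt_eq_zero_iff, LocalizedModule.subsingleton_iff] at h
  obtain ⟨S, hS⟩ := Module.Finite.fg_top (R := R) (M := N₁)
  choose s hs hs0 using h
  refine ⟨∏ m ∈ S, s m, ?_, fun m => ?_⟩
  · exact (𝔭.asIdeal.primeCompl).prod_mem fun m _ => hs m
  · have hm : m ∈ Submodule.span R (S : Set N₁) := by rw [hS]; exact Submodule.mem_top
    induction hm using Submodule.span_induction with
    | mem y hy => rw [← Finset.prod_erase_mul S s hy, mul_smul, hs0, smul_zero]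
    | zero => rw [smul_zero]
    | add y z _ _ hy hz => rw [smul_add, hy, hz, add_zero]
    | smul r y _ hy => rw [smul_comm, hy, smul_zero]

/-- **Cayley–Hamilton / determinant trick.** If `M` is finitely generated and every element of
`M ⧸ 𝔭M` is killed by some element outside the prime `𝔭` (i.e. `M/𝔭M` is a torsion
`R/𝔭`-module), then `M_𝔭 = 0`. [cite: Matsumura1987, Thm. 2.1] -/
theorem lengthAt_eq_zero_of_forall_exists_notMem [Module.Finite R N₁] (𝔭 : PrimeSpectrum R)
    (h : ∀ m : N₁, ∃ s ∉ 𝔭.asIdeal, s • m ∈ 𝔭.asIdeal • (⊤ : Submodule R N₁)) :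
    lengthAt R N₁ 𝔭 = 0 := by
  classical
  obtain ⟨S, hS⟩ := Module.Finite.fg_top (R := R) (M := N₁)
  choose s hs hsm using h
  set σ : R := ∏ m ∈ S, s m with hσdef
  have hσ : σ ∉ 𝔭.asIdeal := fun hmem => by
    obtain ⟨m, -, hm⟩ := Ideal.IsPrime.prod_mem_iff.mp hmem
    exact hs m hm
  have hσM : LinearMap.range (LinearMap.lsmul R N₁ σ) ≤ 𝔭.asIdeal • (⊤ : Submodule R N₁) := by
    rintro _ ⟨m, rfl⟩
    rw [LinearMap.lsmul_apply]
    have hm : m ∈ Submodule.span R (S : Set N₁) := by rw [hS]; exact Submodule.mem_top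
    induction hm using Submodule.span_induction with
    | mem x hx =>
      rw [hσdef, ← Finset.prod_erase_mul S s hx, mul_smul]
      exact Submodule.smul_mem _ _ (hsm x)
    | zero => simp
    | add x y _ _ hx hy => rw [smul_add]; exact add_mem hx hy
    | smul a x _ hx => rw [smul_comm]; exact Submodule.smul_mem _ a hx
  obtain ⟨q, hmonic, -, hcoeff, haeval⟩ :=
    LinearMap.exists_monic_and_natDegree_eq_and_coeff_mem_pow_and_aeval_eq_zero R
      (LinearMap.lsmul R N₁ σ) 𝔭.asIdeal hσM
  -- `t = q(σ)` kills `N₁` and `t ≡ σ^deg q (mod 𝔭)`, so `t ∉ 𝔭`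
  have hsub : q.eval σ - σ ^ q.natDegree ∈ 𝔭.asIdeal := by
    rw [Polynomial.eval_eq_sum_range, Finset.sum_range_succ]
    have hlead : q.coeff q.natDegree = 1 := hmonic
    rw [hlead, one_mul, add_sub_cancel_right]
    refine Ideal.sum_mem _ fun i hi => Ideal.mul_mem_right _ _ ?_
    exact Ideal.pow_le_self (Nat.sub_ne_zero_of_lt (Finset.mem_range.1 hi)) (hcoeff i)
  have ht : q.eval σ ∉ 𝔭.asIdeal := fun hmem => by
    have : σ ^ q.natDegree ∈ 𝔭.asIdeal := by
      have h' := Ideal.sub_mem _ hmem hsub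
      rwa [sub_sub_cancel] at h'
    exact hσ (𝔭.isPrime.mem_of_pow_mem _ this)
  refine lengthAt_eq_zero_of_isTorsionBy (s := q.eval σ) (fun m => ?_) 𝔭 ht
  have hev : Polynomial.aeval (LinearMap.lsmul R N₁ σ) q m = q.eval σ • m := by
    have hh : LinearMap.lsmul R N₁ σ = algebraMap R (Module.End R N₁) σ :=
      LinearMap.ext fun m => by rw [LinearMap.lsmul_apply, Module.algebraMap_end_apply]
    rw [hh, Polynomial.aeval_algebraMap_apply_eq_algebraMap_eval, Module.algebraMap_end_apply]
  rw [← hev, haeval, LinearMap.zero_apply]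

end Generic

end LocalLength

end Summit.BirchSwinnertonDyer.BirchSwinnertonDyer.Theorems.SignedBaseChangeAcDivSpecialization

end
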